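import Mathlib.Analysis.SpecialFunctions.Pow.Real
import Mathlib.Analysis.SpecialFunctions.Sqrt
import Mathlib.Analysis.Complex.Basic
import Mathlib.Algebra.Order.Field.GeomSum
import Mathlib.Tactic.IntervalCases
import HarnessLib

/-!
# Tao–Teräväinen 2022, §8 (`k = 2`, `ℓ = 0`): the local Euler factors of the main term

Topic `Literature/Barriers/Parity`, sub-namespace `TaoTeravainen.MainTerm`; first file of the
Goldston–Yıldırım-type computation (8.8)–(8.25) of T. Tao, J. Teräväinen, *The Hardy–Littlewood–Chowla
conjecture in the presence of a Siegel zero*, J. London Math. Soc. (2) 106 (2022), arXiv:2109.06291,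
§8, case `k = 2`, `ℓ = 0`, a file of the proof DAG of
`Literature.Barriers.Parity.TaoTeravainen2021_prop72_81_pair`. Everything here is PROVED.

The source (after (8.16)): "`E_p := ∑_{d₁,d₂ ∈ ℕ_(p)} ∏ 1_{(d_i,d_j)∣h_i-h_j}/[d₁,d₂] ∏_j c_{d_j,t₀ⱼ,t₁ⱼ,t₂ⱼ}`,
(8.18) `c_{d,t₀,t₁,t₂} := ∑_{[d₀,d₁,d₂] = d} χ(d₀)μ(d₁)μ(d₂) d₀^{-(1+it₀)/log x} d₁^{-(1+it₁)/log R}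
d₂^{-(1+it₂)/log R}` … For `l > 1`, `c_{p^l} = χ(p^l) p^{-l(1+it₀)/log x} (1 - p^{-(1+it₁)/log R})
(1 - p^{-(1+it₂)/log R})` … For `l = 1`, `c_p = (1 + χ(p) p^{-(1+it₀)/log x})(1 - p^{-(1+it₁)/log R})
(1 - p^{-(1+it₂)/log R}) - 1` … Let us compare `c_p` against
`c'_p := (1 - p^{-(1+it₀)/log x})(1 - …)(1 - …) - 1`. The two quantities agree unless `p` is
exceptional."

This file is the single-prime algebra, with the complex parameters kept abstract: for side
`j ∈ {0, 1}` we write `u_j` for `p^{-(1+it₀ⱼ)/log x}` and `v₁ⱼ, v₂ⱼ` for `p^{-(1+it₁ⱼ)/log R}`,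
`p^{-(1+it₂ⱼ)/log R}`, and `χ_p ∈ [-1, 1]` for `χ(p)`; all estimates are in terms of named bounds
`‖1 - u_j‖ ≤ α`, `‖1 - v_{ij}‖ ≤ β`, `‖v_{ij}‖ ≤ γ` (in the application `α = min(2, σ log p/log x)`,
`β = min(2, σ log p/log R)`, `γ = p^{-1/log R}`).

* `cCoeff χ_p u v₁ v₂ = c_p`, `slotC … A = c_{p^A}` (`A = 0, 1, ≥ 2`), `slotC₀ A` its value at
  `u = v = 1` (`1, -1, 0`), and the TRUNCATED local factor
  `localE p v_H L … = ∑_{A,B ≤ L} 1_{min(A,B) ≤ v_H} p^{-max(A,B)} c_{p^A}^{(0)} c_{p^B}^{(1)}`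
  (`v_H = v_p(h₁ - h₂)`; the truncation `L` is harmless because the global sum is finitely
  supported, see the sequel files), `localE₀` its value at `u = v = 1`;
* `localE₀_eq` — `E_p(0) = 1 - 2/p + 1_{p ∣ h₁-h₂}/p` ("`E_p = 1 - m/p + O(…)`", the `m` distinct
  residues of `h₁, h₂` modulo `p`);
* `localE_eq_of_vH_zero`, `sideSum_eq` — for `p ∤ h₁ - h₂`:
  `E_p = 1 + ∑_j (c_p^{(j)}/p + g_j)`, `g_j = (1-v₁ⱼ)(1-v₂ⱼ) ∑_{2 ≤ A ≤ L} (χ_p u_j/p)^A`;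
* `cCoeff_eq` — `c_p = -u + (1-u)((1-v₁)(1-v₂) - 1) + (1+χ_p) u (1-v₁)(1-v₂)` (the last term is
  the exceptional-prime correction `c_p - c'_p`);
* the model `modelDelta` identity `localE_sub_model_eq` comparing `E_p` with
  `β_p (1 - u₀/p)(1 - u₁/p)`, `β_p = (1 - 2/p)(1 - 1/p)^{-2}`, and the bounds `norm_cCoeff_le`,
  `norm_slotC_le`, `norm_slotC_sub_slotC₀_le`, `norm_gTail_le`, `norm_modelDelta_le`,
  `sum_sum_inv_pow_max_le` (`∑_{A,B} p^{-max(A,B)} ≤ 12`), `norm_localE_sub_localE₀_le`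
  (`‖E_p - E_p(0)‖ ≤ 480 β`, for the primes `p < C₀`).
  [cite: TaoTeravainen2021, §8, (8.17)–(8.18) and the displays from (8.22) to (8.25)]
-/

noncomputable section

open Finset

namespace Literature.Barriers.Parity

namespace TaoTeravainen

namespace MainTerm

/-! ### The coefficients `c_{p^A}` of one side -/

/-- `c_p = (1 + χ(p) u)(1 - v₁)(1 - v₂) - 1` ((8.18) at `d = p`: "the sum consists of those terms with
`d₀, d₁, d₂ ∈ {1, p}`, excluding the triple `d₀ = d₁ = d₂ = 1`").
[cite: TaoTeravainen2021, §8 (display after (8.22))] -/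
def cCoeff (χp : ℝ) (u v₁ v₂ : ℂ) : ℂ :=
  (1 + χp * u) * (1 - v₁) * (1 - v₂) - 1

/-- `c_{p^A}`: `1` for `A = 0`, `c_p` for `A = 1`, and `(χ(p)u)^A (1 - v₁)(1 - v₂)` for `A ≥ 2`
("For `l > 1`, the sum in (8.18) only consists of those terms with `d₀ = p^l`").
[cite: TaoTeravainen2021, §8 (8.18) and the display before (8.22)] -/
def slotC (χp : ℝ) (u v₁ v₂ : ℂ) (A : ℕ) : ℂ :=
  if A = 0 then 1 else if A = 1 then cCoeff χp u v₁ v₂ else (χp * u) ^ A * ((1 - v₁) * (1 - v₂))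

/-- The value of `c_{p^A}` at `u = v₁ = v₂ = 1` (all `t` and `1/log` set to `0`): `1, -1, 0, 0, …`
("`c_{d_j} = μ(d_j) + O(…)`"). [cite: TaoTeravainen2021, §8 (display before "This gives")] -/
def slotC₀ (A : ℕ) : ℂ :=
  if A = 0 then 1 else if A = 1 then -1 else 0

/-- `c_{p^0} = 1`. [folklore] -/
@[simp] theorem slotC_zero (χp : ℝ) (u v₁ v₂ : ℂ) : slotC χp u v₁ v₂ 0 = 1 := by
  simp [slotC]

/-- `c_{p^1} = c_p`. [cite: TaoTeravainen2021, §8 (8.18)] -/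
@[simp] theorem slotC_one (χp : ℝ) (u v₁ v₂ : ℂ) : slotC χp u v₁ v₂ 1 = cCoeff χp u v₁ v₂ := by
  simp [slotC]

/-- `c_{p^A} = (χ(p)u)^A (1-v₁)(1-v₂)` for `A ≥ 2`. [cite: TaoTeravainen2021, §8 (display before (8.22))] -/
theorem slotC_of_two_le (χp : ℝ) (u v₁ v₂ : ℂ) {A : ℕ} (hA : 2 ≤ A) :
    slotC χp u v₁ v₂ A = (χp * u) ^ A * ((1 - v₁) * (1 - v₂)) := by
  unfold slotC
  rw [if_neg (by omega), if_neg (by omega)]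

/-- `μ(p^0) = 1`. [folklore] -/
@[simp] theorem slotC₀_zero : slotC₀ 0 = 1 := by simp [slotC₀]

/-- `μ(p) = -1`. [folklore] -/
@[simp] theorem slotC₀_one : slotC₀ 1 = -1 := by simp [slotC₀]

/-- `μ(p^A) = 0` for `A ≥ 2`. [folklore] -/
theorem slotC₀_of_two_le {A : ℕ} (hA : 2 ≤ A) : slotC₀ A = 0 := by
  unfold slotC₀
  rw [if_neg (by omega), if_neg (by omega)]

/-- At `u = v₁ = v₂ = 1` the coefficients are `slotC₀`. [cite: TaoTeravainen2021, §8] -/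
theorem slotC_one_one_one (χp : ℝ) (A : ℕ) : slotC χp 1 1 1 A = slotC₀ A := by
  unfold slotC slotC₀ cCoeff
  split_ifs <;> simp

/-- **The decomposition of `c_p`**: `c_p = -u + (1-u)((1-v₁)(1-v₂) - 1) + (1+χ(p)) u (1-v₁)(1-v₂)`;
the first two terms are `c'_p = (1-u)(1-v₁)(1-v₂) - 1` and the last one is `c_p - c'_p`, which
vanishes unless `p` is exceptional (`χ(p) ≠ -1`). [cite: TaoTeravainen2021, §8 (8.23)–(8.24)] -/
theorem cCoeff_eq (χp : ℝ) (u v₁ v₂ : ℂ) :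
    cCoeff χp u v₁ v₂ =
      -u + (1 - u) * ((1 - v₁) * (1 - v₂) - 1) + (1 + χp) * u * ((1 - v₁) * (1 - v₂)) := by
  unfold cCoeff
  ring

/-! ### Norm bounds for one side -/

section Bounds

variable {χp : ℝ} {u v₁ v₂ : ℂ} {β : ℝ}

/-- `‖(1 - v₁)(1 - v₂)‖ ≤ 2β` when `‖1 - v₁‖ ≤ β` and `‖v₂‖ ≤ 1`. [folklore] -/
theorem norm_one_sub_mul_one_sub_le (hv₁ : ‖1 - v₁‖ ≤ β) (hv₂ : ‖v₂‖ ≤ 1) :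
    ‖(1 - v₁) * (1 - v₂)‖ ≤ 2 * β := by
  have hβ : 0 ≤ β := (norm_nonneg _).trans hv₁
  have h2 : ‖1 - v₂‖ ≤ 2 := by
    calc ‖1 - v₂‖ ≤ ‖(1 : ℂ)‖ + ‖v₂‖ := norm_sub_le _ _
      _ ≤ 1 + 1 := by rw [norm_one]; linarith
      _ = 2 := by norm_num
  rw [norm_mul]
  calc ‖1 - v₁‖ * ‖1 - v₂‖ ≤ β * 2 := mul_le_mul hv₁ h2 (norm_nonneg _) hβ
    _ = 2 * β := by ring

/-- `‖(1 - v₁)(1 - v₂)‖ ≤ 4` when `‖v₁‖, ‖v₂‖ ≤ 1`. [folklore] -/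
theorem norm_one_sub_mul_one_sub_le_four (hv₁ : ‖v₁‖ ≤ 1) (hv₂ : ‖v₂‖ ≤ 1) :
    ‖(1 - v₁) * (1 - v₂)‖ ≤ 4 := by
  have h1 : ‖1 - v₁‖ ≤ 2 := by
    calc ‖1 - v₁‖ ≤ ‖(1 : ℂ)‖ + ‖v₁‖ := norm_sub_le _ _
      _ ≤ 2 := by rw [norm_one]; linarith
  have := norm_one_sub_mul_one_sub_le h1 hv₂
  linarith

/-- `‖c_p‖ ≤ 9` (`‖1 + χ(p)u‖ ≤ 2`, `‖1 - v‖ ≤ 2`). [cite: TaoTeravainen2021, §8 ("the trivial bound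
`c_p ≪ 1`")] -/
theorem norm_cCoeff_le (hχ : |χp| ≤ 1) (hu : ‖u‖ ≤ 1) (hv₁ : ‖v₁‖ ≤ 1) (hv₂ : ‖v₂‖ ≤ 1) :
    ‖cCoeff χp u v₁ v₂‖ ≤ 9 := by
  unfold cCoeff
  have h1 : ‖1 + (χp : ℂ) * u‖ ≤ 2 := by
    calc ‖1 + (χp : ℂ) * u‖ ≤ ‖(1 : ℂ)‖ + ‖(χp : ℂ) * u‖ := norm_add_le _ _
      _ ≤ 1 + 1 := by
          rw [norm_one, norm_mul, Complex.norm_real, Real.norm_eq_abs]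
          gcongr
          calc |χp| * ‖u‖ ≤ 1 * 1 := mul_le_mul hχ hu (norm_nonneg _) zero_le_one
            _ = 1 := one_mul 1
      _ = 2 := by norm_num
  have h2 := norm_one_sub_mul_one_sub_le_four hv₁ hv₂
  calc ‖(1 + (χp : ℂ) * u) * (1 - v₁) * (1 - v₂) - 1‖
      ≤ ‖(1 + (χp : ℂ) * u) * (1 - v₁) * (1 - v₂)‖ + ‖(1 : ℂ)‖ := norm_sub_le _ _
    _ = ‖1 + (χp : ℂ) * u‖ * ‖(1 - v₁) * (1 - v₂)‖ + 1 := by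
        rw [mul_assoc, norm_mul, norm_one]
    _ ≤ 2 * 4 + 1 := by gcongr
    _ = 9 := by norm_num

/-- `‖c_{p^A}‖ ≤ 9` for every `A`. [cite: TaoTeravainen2021, §8 (8.22)] -/
theorem norm_slotC_le (hχ : |χp| ≤ 1) (hu : ‖u‖ ≤ 1) (hv₁ : ‖v₁‖ ≤ 1) (hv₂ : ‖v₂‖ ≤ 1) (A : ℕ) :
    ‖slotC χp u v₁ v₂ A‖ ≤ 9 := by
  rcases Nat.lt_or_ge A 2 with hA | hA
  · interval_cases A
    · simp
    · rw [slotC_one]; exact norm_cCoeff_le hχ hu hv₁ hv₂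
  · rw [slotC_of_two_le _ _ _ _ hA, norm_mul, norm_pow, norm_mul, Complex.norm_real,
      Real.norm_eq_abs]
    have h1 : (|χp| * ‖u‖) ^ A ≤ 1 := pow_le_one₀ (by positivity)
      (by calc |χp| * ‖u‖ ≤ 1 * 1 := mul_le_mul hχ hu (norm_nonneg _) zero_le_one
             _ = 1 := one_mul 1)
    have h2 := norm_one_sub_mul_one_sub_le_four hv₁ hv₂
    calc (|χp| * ‖u‖) ^ A * ‖(1 - v₁) * (1 - v₂)‖ ≤ 1 * 4 :=
          mul_le_mul h1 h2 (norm_nonneg _) zero_le_one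
      _ ≤ 9 := by norm_num

/-- `‖slotC₀ A‖ ≤ 1`. [folklore] -/
theorem norm_slotC₀_le (A : ℕ) : ‖slotC₀ A‖ ≤ 1 := by
  unfold slotC₀
  split_ifs <;> simp

/-- **`c_{p^A}` is close to `μ(p^A)`**: `‖c_{p^A} - c_{p^A}(0)‖ ≤ 4β` when `‖1 - v₁‖ ≤ β` (`A = 1`:
`‖(1+χu)(1-v₁)(1-v₂)‖ ≤ 2·β·2`; `A ≥ 2`: `‖(χu)^A (1-v₁)(1-v₂)‖ ≤ 2β`). This is "`c_{d_j} = μ(d_j) +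
O(1/log^{1/(7k)} η)`" for the small primes. [cite: TaoTeravainen2021, §8 (the two displays before "This gives")] -/
theorem norm_slotC_sub_slotC₀_le (hχ : |χp| ≤ 1) (hu : ‖u‖ ≤ 1) (hv₁ : ‖1 - v₁‖ ≤ β)
    (hv₂ : ‖v₂‖ ≤ 1) (A : ℕ) : ‖slotC χp u v₁ v₂ A - slotC₀ A‖ ≤ 4 * β := by
  have hβ : 0 ≤ β := (norm_nonneg _).trans hv₁
  have hP := norm_one_sub_mul_one_sub_le hv₁ hv₂
  have hχu : ‖(χp : ℂ) * u‖ ≤ 1 := by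
    rw [norm_mul, Complex.norm_real, Real.norm_eq_abs]
    calc |χp| * ‖u‖ ≤ 1 * 1 := mul_le_mul hχ hu (norm_nonneg _) zero_le_one
      _ = 1 := one_mul 1
  rcases Nat.lt_or_ge A 2 with hA | hA
  · interval_cases A
    · simp; positivity
    · rw [slotC_one, slotC₀_one, cCoeff,
        show (1 + (χp : ℂ) * u) * (1 - v₁) * (1 - v₂) - 1 - -1 =
          (1 + (χp : ℂ) * u) * ((1 - v₁) * (1 - v₂)) by ring, norm_mul]
      have h1 : ‖1 + (χp : ℂ) * u‖ ≤ 2 := by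
        calc ‖1 + (χp : ℂ) * u‖ ≤ ‖(1 : ℂ)‖ + ‖(χp : ℂ) * u‖ := norm_add_le _ _
          _ ≤ 1 + 1 := by rw [norm_one]; linarith
          _ = 2 := by norm_num
      calc ‖1 + (χp : ℂ) * u‖ * ‖(1 - v₁) * (1 - v₂)‖ ≤ 2 * (2 * β) :=
            mul_le_mul h1 hP (norm_nonneg _) (by norm_num)
        _ = 4 * β := by ring
  · rw [slotC_of_two_le _ _ _ _ hA, slotC₀_of_two_le hA, sub_zero, norm_mul, norm_pow]
    have h1 : ‖(χp : ℂ) * u‖ ^ A ≤ 1 := pow_le_one₀ (norm_nonneg _) hχu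
    calc ‖(χp : ℂ) * u‖ ^ A * ‖(1 - v₁) * (1 - v₂)‖ ≤ 1 * (2 * β) :=
          mul_le_mul h1 hP (norm_nonneg _) zero_le_one
      _ ≤ 4 * β := by linarith

end Bounds

/-! ### The truncated local factor `E_p` -/

/-- **The local Euler factor at `p`, truncated at valuations `≤ L`**:
`E_p = ∑_{A, B ≤ L} 1_{min(A,B) ≤ v_H} p^{-max(A,B)} c_{p^A}^{(0)} c_{p^B}^{(1)}`, where `v_H = v_p(h₁-h₂)`
and `1_{min(A,B) ≤ v_H} p^{-max(A,B)}` is the `p`-part of `1_{(d₁,d₂)∣h₁-h₂}/[d₁,d₂]` at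
`(v_p d₁, v_p d₂) = (A, B)` (cf. `crtDensity_eq_prod_primes`). The side data are `u j, v₁ j, v₂ j`
(`j : Fin 2`). [cite: TaoTeravainen2021, §8 (8.17)] -/
def localE (p vH L : ℕ) (χp : ℝ) (u v₁ v₂ : Fin 2 → ℂ) : ℂ :=
  ∑ A ∈ range (L + 1), ∑ B ∈ range (L + 1),
    if min A B ≤ vH then
      ((p : ℂ) ^ max A B)⁻¹ * (slotC χp (u 0) (v₁ 0) (v₂ 0) A * slotC χp (u 1) (v₁ 1) (v₂ 1) B)
    else 0

/-- The value of `E_p` at `u = v = 1`. [cite: TaoTeravainen2021, §8] -/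
def localE₀ (p vH L : ℕ) : ℂ :=
  ∑ A ∈ range (L + 1), ∑ B ∈ range (L + 1),
    if min A B ≤ vH then ((p : ℂ) ^ max A B)⁻¹ * (slotC₀ A * slotC₀ B) else 0

/-- `E_p` at `u = v = 1` is `localE₀`. [folklore] -/
theorem localE_one_one_one (p vH L : ℕ) (χp : ℝ) :
    localE p vH L χp (fun _ => 1) (fun _ => 1) (fun _ => 1) = localE₀ p vH L := by
  unfold localE localE₀
  simp only [slotC_one_one_one]

/-- **`E_p(0) = 1 - m/p`** with `m` the number of residues of `h₁, h₂` modulo `p`: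
`E_p(0) = 1 - 2/p + 1_{1 ≤ v_H}/p` (for `L ≥ 1`, `p ≠ 0`). ("From the alternating sign of the Möbius
function, each `j` has a net contribution of `-1/p`".) [cite: TaoTeravainen2021, §8 (display "E_p = 1 - m/p + O(…)")] -/
theorem localE₀_eq {p : ℕ} (hp : p ≠ 0) (vH : ℕ) {L : ℕ} (hL : 1 ≤ L) :
    localE₀ p vH L = 1 - 2 / (p : ℂ) + (if 1 ≤ vH then 1 / (p : ℂ) else 0) := by
  unfold localE₀
  have hp' : (p : ℂ) ≠ 0 := Nat.cast_ne_zero.mpr hp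
  -- restrict both sums to `range 2`
  have hsub : range 2 ⊆ range (L + 1) := range_subset_range.mpr (by omega)
  have hvan : ∀ A, A ∉ range 2 → slotC₀ A = 0 := fun A hA => by
    rw [mem_range, not_lt] at hA
    exact slotC₀_of_two_le hA
  rw [← sum_subset hsub (fun A _ hA => ?_)]
  · have hinner : ∀ A ∈ range 2,
        ∑ B ∈ range (L + 1), (if min A B ≤ vH then ((p : ℂ) ^ max A B)⁻¹ * (slotC₀ A * slotC₀ B) else 0) =
        ∑ B ∈ range 2, (if min A B ≤ vH then ((p : ℂ) ^ max A B)⁻¹ * (slotC₀ A * slotC₀ B) else 0) := by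
      intro A _
      rw [← sum_subset hsub (fun B _ hB => ?_)]
      rw [hvan B hB, mul_zero, mul_zero, ite_self]
    rw [sum_congr rfl hinner]
    simp only [sum_range_succ, sum_range_zero, zero_add, slotC₀_zero, slotC₀_one]
    simp only [Nat.min_self, zero_le, ↓reduceIte, Nat.max_self, pow_zero, inv_one, mul_one,
      Nat.zero_min, Nat.zero_max, pow_one, mul_neg, Nat.min_zero, Nat.max_zero, neg_neg]
    split_ifs <;> field_simp <;> ring
  · -- rows with `A ≥ 2` vanish
    refine sum_eq_zero fun B _ => ?_
    rw [hvan A hA, zero_mul, mul_zero, ite_self]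

/-! ### The generic primes `p ∤ h₁ - h₂`: closed form -/

/-- The side sum `∑_{1 ≤ A ≤ L} p^{-A} c_{p^A}`. [cite: TaoTeravainen2021, §8 ("E_p = 1 + ∑_j ∑_l c_{p^l}/p^l")] -/
def sideSum (p L : ℕ) (χp : ℝ) (u v₁ v₂ : ℂ) : ℂ :=
  ∑ A ∈ Ico 1 (L + 1), ((p : ℂ) ^ A)⁻¹ * slotC χp u v₁ v₂ A

/-- The tail `g = (1-v₁)(1-v₂) ∑_{2 ≤ A ≤ L} (χ(p)u/p)^A` of the side sum (the terms `l > 1`).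
[cite: TaoTeravainen2021, §8 (8.22)] -/
def gTail (p L : ℕ) (χp : ℝ) (u v₁ v₂ : ℂ) : ℂ :=
  (1 - v₁) * (1 - v₂) * ∑ A ∈ Ico 2 (L + 1), ((χp : ℂ) * u / p) ^ A

/-- **`p ∤ h₁ - h₂`: at most one of `d₁, d₂` is divisible by `p`**, so
`E_p = 1 + ∑_j ∑_{1 ≤ A ≤ L} p^{-A} c^{(j)}_{p^A}`. [cite: TaoTeravainen2021, §8 ("in order for the
sum in (8.17) to be non-zero, at most one of the `d_j` can be greater than `1`")] -/
theorem localE_eq_of_vH_zero (p L : ℕ) (χp : ℝ) (u v₁ v₂ : Fin 2 → ℂ) :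
    localE p 0 L χp u v₁ v₂ =
      1 + sideSum p L χp (u 0) (v₁ 0) (v₂ 0) + sideSum p L χp (u 1) (v₁ 1) (v₂ 1) := by
  unfold localE sideSum
  rw [range_eq_Ico, sum_eq_sum_Ico_succ_bot (by omega : 0 < L + 1)]
  -- the row `A = 0`
  have hrow : ∑ B ∈ Ico 0 (L + 1),
      (if min 0 B ≤ 0 then ((p : ℂ) ^ max 0 B)⁻¹ *
        (slotC χp (u 0) (v₁ 0) (v₂ 0) 0 * slotC χp (u 1) (v₁ 1) (v₂ 1) B) else 0) =
      1 + ∑ B ∈ Ico 1 (L + 1), ((p : ℂ) ^ B)⁻¹ * slotC χp (u 1) (v₁ 1) (v₂ 1) B := by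
    rw [sum_eq_sum_Ico_succ_bot (by omega : 0 < L + 1)]
    simp only [Nat.zero_min, le_refl, ↓reduceIte, Nat.zero_max, pow_zero, inv_one, slotC_zero,
      one_mul]
  -- the rows `A ≥ 1`: only `B = 0` survives
  have hrows : ∀ A ∈ Ico 1 (L + 1), ∑ B ∈ Ico 0 (L + 1),
      (if min A B ≤ 0 then ((p : ℂ) ^ max A B)⁻¹ *
        (slotC χp (u 0) (v₁ 0) (v₂ 0) A * slotC χp (u 1) (v₁ 1) (v₂ 1) B) else 0) =
      ((p : ℂ) ^ A)⁻¹ * slotC χp (u 0) (v₁ 0) (v₂ 0) A := by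
    intro A hA
    rw [mem_Ico] at hA
    rw [sum_eq_sum_Ico_succ_bot (by omega : 0 < L + 1)]
    simp only [Nat.min_zero, le_refl, ↓reduceIte, Nat.max_zero, slotC_zero, mul_one]
    rw [sum_eq_zero fun B hB => ?_, add_zero]
    rw [mem_Ico] at hB
    rw [if_neg (by omega)]
  rw [hrow, sum_congr rfl hrows]
  ring

/-- **The side sum is `c_p/p` plus the tail**: `∑_{1 ≤ A ≤ L} p^{-A} c_{p^A} = c_p/p + g`
(`L ≥ 1`). [cite: TaoTeravainen2021, §8 ("We thus have E_p = 1 + ∑_j c_p/p … + O(…)")] -/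
theorem sideSum_eq {p : ℕ} (hp : p ≠ 0) {L : ℕ} (hL : 1 ≤ L) (χp : ℝ) (u v₁ v₂ : ℂ) :
    sideSum p L χp u v₁ v₂ = cCoeff χp u v₁ v₂ / p + gTail p L χp u v₁ v₂ := by
  unfold sideSum gTail
  have hp' : (p : ℂ) ≠ 0 := Nat.cast_ne_zero.mpr hp
  rw [sum_eq_sum_Ico_succ_bot (by omega : 1 < L + 1), pow_one, slotC_one, mul_sum]
  congr 1
  · rw [div_eq_inv_mul]
  · refine sum_congr rfl fun A hA => ?_
    rw [mem_Ico] at hA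
    rw [slotC_of_two_le _ _ _ _ hA.1, div_pow, mul_pow]
    field_simp

/-- `‖g‖ ≤ ‖(1-v₁)(1-v₂)‖ · 2/p²` (`p ≥ 2`, `|χ(p)| ≤ 1`, `‖u‖ ≤ 1`): the terms `l ≥ 2` are
`O(min((1+|t|) log_R p, 1)²/p²)`. [cite: TaoTeravainen2021, §8 (8.22) and the display after it] -/
theorem norm_gTail_le {p : ℕ} (hp : 2 ≤ p) (L : ℕ) {χp : ℝ} (hχ : |χp| ≤ 1) {u v₁ v₂ : ℂ}
    (hu : ‖u‖ ≤ 1) :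
    ‖gTail p L χp u v₁ v₂‖ ≤ ‖(1 - v₁) * (1 - v₂)‖ * (2 / (p : ℝ) ^ 2) := by
  unfold gTail
  rw [norm_mul]
  refine mul_le_mul_of_nonneg_left ?_ (norm_nonneg _)
  have hp0 : (0 : ℝ) < p := by exact_mod_cast (show 0 < p by omega)
  have hp2 : (2 : ℝ) ≤ p := by exact_mod_cast hp
  set r : ℝ := 1 / (p : ℝ) with hr
  have hr0 : 0 ≤ r := by positivity
  have hr1 : r < 1 := by rw [hr, div_lt_one hp0]; linarith
  have hrhalf : r ≤ 1 / 2 := by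
    rw [hr]; exact one_div_le_one_div_of_le (by norm_num) hp2
  have hterm : ∀ A, ‖((χp : ℂ) * u / p) ^ A‖ ≤ r ^ A := fun A => by
    rw [norm_pow]
    refine pow_le_pow_left₀ (norm_nonneg _) ?_ A
    rw [norm_div, norm_mul, Complex.norm_real, Real.norm_eq_abs, Complex.norm_natCast, hr]
    refine div_le_div_of_nonneg_right ?_ hp0.le
    calc |χp| * ‖u‖ ≤ 1 * 1 := mul_le_mul hχ hu (norm_nonneg _) zero_le_one
      _ = 1 := one_mul 1
  calc ‖∑ A ∈ Ico 2 (L + 1), ((χp : ℂ) * u / p) ^ A‖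
      ≤ ∑ A ∈ Ico 2 (L + 1), ‖((χp : ℂ) * u / p) ^ A‖ := norm_sum_le _ _
    _ ≤ ∑ A ∈ Ico 2 (L + 1), r ^ A := sum_le_sum fun A _ => hterm A
    _ ≤ r ^ 2 / (1 - r) := geom_sum_Ico_le_of_lt_one hr0 hr1
    _ ≤ r ^ 2 / (1 / 2) := by
        refine div_le_div_of_nonneg_left (by positivity) (by norm_num) (by linarith)
    _ = 2 / (p : ℝ) ^ 2 := by rw [hr]; field_simp

/-! ### The model `β_p (1 - u₀/p)(1 - u₁/p)` for the generic primes -/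

/-- The discrepancy between `1 + ∑_j c'_p^{(j)}/p` and the model `β_p ∏_j (1 - u_j/p)`,
`β_p = (1 - 2/p)(1 - 1/p)^{-2} = 1 - κ`, `κ = (p-1)^{-2}`, in closed form:
`Δ_p = ∑_j (1-u_j)((1-v₁ⱼ)(1-v₂ⱼ) - 1)/p - (u₀u₁ - 1)(1-κ)/p² + κ((1-u₀) + (1-u₁))/p`.
[cite: TaoTeravainen2021, §8 (the comparison of `∏_{p ≥ C₀} E_p` with `∏ β_p ∏_j (1 - p^{-1-(1+it₀ⱼ)/log x})`, (8.25))] -/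
def modelDelta (p : ℕ) (u v₁ v₂ : Fin 2 → ℂ) : ℂ :=
  ∑ j : Fin 2, (1 - u j) * ((1 - v₁ j) * (1 - v₂ j) - 1) / p -
    (u 0 * u 1 - 1) * (1 - 1 / ((p : ℂ) - 1) ^ 2) / (p : ℂ) ^ 2 +
    (1 / ((p : ℂ) - 1) ^ 2) * ((1 - u 0) + (1 - u 1)) / p

/-- **`E_p` against the model, `p ∤ h₁ - h₂`, `p ≥ 2`, `L ≥ 1`**:
`E_p - β_p (1 - u₀/p)(1 - u₁/p) = Δ_p + ∑_j (1+χ(p)) u_j (1-v₁ⱼ)(1-v₂ⱼ)/p + ∑_j g_j`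
with `β_p = (1 - 2/p)((1 - 1/p)⁻¹)²` (the singular-series factor for two distinct residues).
[cite: TaoTeravainen2021, §8 (8.23)–(8.25)] -/
theorem localE_sub_model_eq {p : ℕ} (hp : 2 ≤ p) {L : ℕ} (hL : 1 ≤ L) (χp : ℝ)
    (u v₁ v₂ : Fin 2 → ℂ) :
    localE p 0 L χp u v₁ v₂ -
        (1 - 2 / (p : ℂ)) * ((1 - 1 / (p : ℂ))⁻¹) ^ 2 * (1 - u 0 / p) * (1 - u 1 / p) =
      modelDelta p u v₁ v₂ +
        ∑ j : Fin 2, (1 + χp) * u j * ((1 - v₁ j) * (1 - v₂ j)) / p +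
        ∑ j : Fin 2, gTail p L χp (u j) (v₁ j) (v₂ j) := by
  have hp0 : (p : ℂ) ≠ 0 := Nat.cast_ne_zero.mpr (by omega)
  have hp1 : (p : ℂ) - 1 ≠ 0 := by
    have h1 : (p : ℂ) ≠ 1 := by exact_mod_cast (show p ≠ 1 by omega)
    exact sub_ne_zero.mpr h1
  rw [localE_eq_of_vH_zero, sideSum_eq (by omega) hL, sideSum_eq (by omega) hL, cCoeff_eq,
    cCoeff_eq]
  unfold modelDelta
  simp only [Fin.sum_univ_two]
  field_simp
  ring

section ModelBounds

variable {p : ℕ} {u v₁ v₂ : Fin 2 → ℂ} {α γ : ℝ}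

/-- `‖v₁v₂ - v₁ - v₂‖ = ‖(1-v₁)(1-v₂) - 1‖ ≤ 3γ` when `‖v_i‖ ≤ γ ≤ 1`. [folklore] -/
theorem norm_one_sub_mul_one_sub_sub_one_le {a b : ℂ} (hγ1 : γ ≤ 1) (ha : ‖a‖ ≤ γ) (hb : ‖b‖ ≤ γ) :
    ‖(1 - a) * (1 - b) - 1‖ ≤ 3 * γ := by
  have hγ0 : 0 ≤ γ := (norm_nonneg _).trans ha
  rw [show (1 - a) * (1 - b) - 1 = a * b - a - b by ring]
  calc ‖a * b - a - b‖ ≤ ‖a * b - a‖ + ‖b‖ := norm_sub_le _ _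
    _ ≤ ‖a * b‖ + ‖a‖ + ‖b‖ := by linarith [norm_sub_le (a * b) a]
    _ = ‖a‖ * ‖b‖ + ‖a‖ + ‖b‖ := by rw [norm_mul]
    _ ≤ γ * 1 + γ + γ := by
        gcongr
        exact hb.trans hγ1
    _ = 3 * γ := by ring

/-- **The size of `Δ_p`** (`p ≥ 2`): if `‖1 - u_j‖ ≤ α`, `‖u_j‖ ≤ 1`, `‖v_{ij}‖ ≤ γ ≤ 1` then
`‖Δ_p‖ ≤ 6αγ/p + 2α/p² + 8α/p³` — in the application `α = min(2, σ log p/log x)`,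
`γ = p^{-1/log R}`, and summed over `p` this is `≪ σ a log(1/a)`, `a = log R/log x`
("`∑_p min(log_R p/log^{1/(6k)} η, exp(-2 log_R p))/p ≪ 1/log^{1/(7k)} η`").
[cite: TaoTeravainen2021, §8 (8.24)–(8.25)] -/
theorem norm_modelDelta_le (hp : 2 ≤ p) (hα : ∀ j, ‖1 - u j‖ ≤ α) (hu : ∀ j, ‖u j‖ ≤ 1)
    (hγ1 : γ ≤ 1) (hv₁ : ∀ j, ‖v₁ j‖ ≤ γ) (hv₂ : ∀ j, ‖v₂ j‖ ≤ γ) :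
    ‖modelDelta p u v₁ v₂‖ ≤
      6 * α * γ / p + 2 * α / (p : ℝ) ^ 2 + 8 * α / (p : ℝ) ^ 3 := by
  have hα0 : 0 ≤ α := (norm_nonneg _).trans (hα 0)
  have hγ0 : 0 ≤ γ := (norm_nonneg _).trans (hv₁ 0)
  have hp0 : (0 : ℝ) < p := by exact_mod_cast (show 0 < p by omega)
  have hp2 : (2 : ℝ) ≤ p := by exact_mod_cast hp
  have hnp : ‖(p : ℂ)‖ = p := Complex.norm_natCast p
  -- the constant `κ = 1/(p-1)²`
  have hκ : ‖(1 : ℂ) / ((p : ℂ) - 1) ^ 2‖ ≤ 4 / (p : ℝ) ^ 2 := by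
    rw [norm_div, norm_one, norm_pow]
    have h1 : ‖(p : ℂ) - 1‖ = (p : ℝ) - 1 := by
      rw [show (p : ℂ) - 1 = (((p : ℝ) - 1 : ℝ) : ℂ) by push_cast; ring, Complex.norm_real,
        Real.norm_eq_abs, abs_of_nonneg (by linarith)]
    rw [h1, div_le_div_iff₀ (by nlinarith) (by positivity)]
    nlinarith
  have hκ1 : ‖1 - (1 : ℂ) / ((p : ℂ) - 1) ^ 2‖ ≤ 1 := by
    have h1 : (1 : ℂ) / ((p : ℂ) - 1) ^ 2 = (((1 : ℝ) / ((p : ℝ) - 1) ^ 2 : ℝ) : ℂ) := by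
      push_cast; ring
    rw [h1, ← Complex.ofReal_one, ← Complex.ofReal_sub, Complex.norm_real, Real.norm_eq_abs]
    have h2 : 0 ≤ (1 : ℝ) / ((p : ℝ) - 1) ^ 2 := by positivity
    have h3 : (1 : ℝ) / ((p : ℝ) - 1) ^ 2 ≤ 1 := by
      rw [div_le_one (by nlinarith)]; nlinarith
    rw [abs_of_nonneg (by linarith)]
    linarith
  -- the three groups of terms
  have hA : ∀ j, ‖(1 - u j) * ((1 - v₁ j) * (1 - v₂ j) - 1) / (p : ℂ)‖ ≤ α * (3 * γ) / p := by
    intro j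
    rw [norm_div, norm_mul, hnp]
    gcongr
    · exact hα j
    · exact norm_one_sub_mul_one_sub_sub_one_le hγ1 (hv₁ j) (hv₂ j)
  have hB : ‖(u 0 * u 1 - 1) * (1 - 1 / ((p : ℂ) - 1) ^ 2) / (p : ℂ) ^ 2‖ ≤ 2 * α / (p : ℝ) ^ 2 := by
    rw [norm_div, norm_mul, norm_pow, hnp]
    refine div_le_div_of_nonneg_right ?_ (by positivity)
    calc ‖u 0 * u 1 - 1‖ * ‖1 - 1 / ((p : ℂ) - 1) ^ 2‖ ≤ (2 * α) * 1 := by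
          refine mul_le_mul ?_ hκ1 (norm_nonneg _) (by positivity)
          rw [show u 0 * u 1 - 1 = u 0 * (u 1 - 1) + (u 0 - 1) by ring]
          calc ‖u 0 * (u 1 - 1) + (u 0 - 1)‖ ≤ ‖u 0 * (u 1 - 1)‖ + ‖u 0 - 1‖ := norm_add_le _ _
            _ = ‖u 0‖ * ‖1 - u 1‖ + ‖1 - u 0‖ := by rw [norm_mul, norm_sub_rev (u 1), norm_sub_rev (u 0)]
            _ ≤ 1 * α + α := by gcongr <;> first | exact hu 0 | exact hα 1 | exact hα 0
            _ = 2 * α := by ring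
      _ = 2 * α := mul_one _
  have hC : ‖(1 / ((p : ℂ) - 1) ^ 2) * ((1 - u 0) + (1 - u 1)) / (p : ℂ)‖ ≤ (4 / (p : ℝ) ^ 2) * (2 * α) / p := by
    rw [norm_div, norm_mul, hnp]
    gcongr
    calc ‖(1 - u 0) + (1 - u 1)‖ ≤ ‖1 - u 0‖ + ‖1 - u 1‖ := norm_add_le _ _
      _ ≤ α + α := add_le_add (hα 0) (hα 1)
      _ = 2 * α := by ring
  unfold modelDelta
  simp only [Fin.sum_univ_two]
  calc _ ≤ ‖(1 - u 0) * ((1 - v₁ 0) * (1 - v₂ 0) - 1) / (p : ℂ) +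
          (1 - u 1) * ((1 - v₁ 1) * (1 - v₂ 1) - 1) / (p : ℂ)‖ +
        ‖(u 0 * u 1 - 1) * (1 - 1 / ((p : ℂ) - 1) ^ 2) / (p : ℂ) ^ 2‖ +
        ‖(1 / ((p : ℂ) - 1) ^ 2) * ((1 - u 0) + (1 - u 1)) / (p : ℂ)‖ := by
          refine (norm_add_le _ _).trans ?_
          gcongr
          exact norm_sub_le _ _
    _ ≤ (α * (3 * γ) / p + α * (3 * γ) / p) + 2 * α / (p : ℝ) ^ 2 + (4 / (p : ℝ) ^ 2) * (2 * α) / p := by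
          gcongr
          exact (norm_add_le _ _).trans (add_le_add (hA 0) (hA 1))
    _ = 6 * α * γ / p + 2 * α / (p : ℝ) ^ 2 + 8 * α / (p : ℝ) ^ 3 := by
          field_simp
          ring

/-- The model is close to `1`: `‖β_p (1 - u₀/p)(1 - u₁/p) - 1‖ ≤ 4/p` for `p ≥ 3`, `‖u_j‖ ≤ 1`.
[cite: TaoTeravainen2021, §8 ("each factor here is `1 + O(1/p²)`")] -/
theorem norm_model_sub_one_le (hp : 3 ≤ p) (hu : ∀ j, ‖u j‖ ≤ 1) :
    ‖(1 - 2 / (p : ℂ)) * ((1 - 1 / (p : ℂ))⁻¹) ^ 2 * (1 - u 0 / p) * (1 - u 1 / p) - 1‖ ≤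
      4 / (p : ℝ) := by
  have hp0 : (0 : ℝ) < p := by exact_mod_cast (show 0 < p by omega)
  have hp3 : (3 : ℝ) ≤ p := by exact_mod_cast hp
  have hpc : (p : ℂ) ≠ 0 := Nat.cast_ne_zero.mpr (by omega)
  have hnp : ‖(p : ℂ)‖ = p := Complex.norm_natCast p
  -- `β_p = 1 - κ`, real in `[1/2, 1]`
  set b : ℝ := (1 - 2 / (p : ℝ)) * ((1 - 1 / (p : ℝ))⁻¹) ^ 2 with hb
  have hbC : (1 - 2 / (p : ℂ)) * ((1 - 1 / (p : ℂ))⁻¹) ^ 2 = (b : ℂ) := by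
    rw [hb]; push_cast; ring
  have hb_eq : b = 1 - 1 / ((p : ℝ) - 1) ^ 2 := by
    rw [hb]
    have : (p : ℝ) - 1 ≠ 0 := by linarith
    field_simp
    ring
  have hb1 : b ≤ 1 := by rw [hb_eq]; linarith [show 0 ≤ 1 / ((p : ℝ) - 1) ^ 2 by positivity]
  have hb0 : 0 ≤ b := by
    rw [hb_eq, sub_nonneg, div_le_one (by nlinarith)]
    nlinarith
  have h1b : 1 - b ≤ 1 / (p : ℝ) := by
    rw [hb_eq, sub_sub_cancel, div_le_div_iff₀ (by nlinarith) hp0]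
    nlinarith
  -- `(1 - u₀/p)(1 - u₁/p) - 1`
  have hprod : ‖(1 - u 0 / (p : ℂ)) * (1 - u 1 / p) - 1‖ ≤ 3 / (p : ℝ) := by
    have hγ : ∀ j, ‖u j / (p : ℂ)‖ ≤ 1 / (p : ℝ) := fun j => by
      rw [norm_div, hnp]; gcongr; exact hu j
    have h13 : 1 / (p : ℝ) ≤ 1 := by rw [div_le_one hp0]; linarith
    calc _ ≤ 3 * (1 / (p : ℝ)) := norm_one_sub_mul_one_sub_sub_one_le h13 (hγ 0) (hγ 1)
      _ = 3 / (p : ℝ) := by ring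
  rw [hbC]
  calc ‖(b : ℂ) * (1 - u 0 / p) * (1 - u 1 / p) - 1‖
      = ‖(b : ℂ) * ((1 - u 0 / p) * (1 - u 1 / p) - 1) - (1 - b)‖ := by ring_nf
    _ ≤ ‖(b : ℂ) * ((1 - u 0 / p) * (1 - u 1 / p) - 1)‖ + ‖((1 : ℂ) - b)‖ := norm_sub_le _ _
    _ = b * ‖(1 - u 0 / (p : ℂ)) * (1 - u 1 / p) - 1‖ + (1 - b) := by
        rw [norm_mul, Complex.norm_real, Real.norm_eq_abs, abs_of_nonneg hb0,
          ← Complex.ofReal_one, ← Complex.ofReal_sub, Complex.norm_real, Real.norm_eq_abs,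
          abs_of_nonneg (by linarith)]
    _ ≤ 1 * (3 / (p : ℝ)) + 1 / (p : ℝ) := by gcongr
    _ = 4 / (p : ℝ) := by ring

end ModelBounds

/-! ### The small primes: `E_p` is close to `E_p(0)` -/

/-- **`∑_{A, B ≤ L} p^{-max(A,B)} ≤ 12`** for `p ≥ 2` (`p^{-max(A,B)} ≤ y^{A+B}`, `y = p^{-1/2} ≤ 2^{-1/2}`,
and `(1 - y)^{-2} ≤ 12`). [folklore] -/
theorem sum_sum_inv_pow_max_le {p : ℕ} (hp : 2 ≤ p) (L : ℕ) :
    ∑ A ∈ range (L + 1), ∑ B ∈ range (L + 1), ((p : ℝ) ^ max A B)⁻¹ ≤ 12 := by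
  have hp0 : (0 : ℝ) < p := by exact_mod_cast (show 0 < p by omega)
  have hp2 : (2 : ℝ) ≤ p := by exact_mod_cast hp
  set y : ℝ := Real.sqrt (1 / (p : ℝ)) with hy
  have hy0 : 0 ≤ y := Real.sqrt_nonneg _
  have hy2 : y ^ 2 = 1 / (p : ℝ) := Real.sq_sqrt (by positivity)
  have hyle : y ≤ 0.7072 := by
    rw [hy, Real.sqrt_le_left (by norm_num)]
    calc 1 / (p : ℝ) ≤ 1 / 2 := one_div_le_one_div_of_le (by norm_num) hp2
      _ ≤ (0.7072 : ℝ) ^ 2 := by norm_num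
  have hy1 : y < 1 := by linarith
  -- termwise: `p^{-max(A,B)} = y^{2 max(A,B)} ≤ y^{A+B}`
  have hterm : ∀ A B : ℕ, ((p : ℝ) ^ max A B)⁻¹ ≤ y ^ A * y ^ B := by
    intro A B
    have h1 : ((p : ℝ) ^ max A B)⁻¹ = y ^ (2 * max A B) := by
      rw [pow_mul, hy2, one_div, inv_pow]
    rw [h1, ← pow_add]
    exact pow_le_pow_of_le_one hy0 hy1.le (by omega)
  have hgeom : ∑ A ∈ range (L + 1), y ^ A ≤ (1 - y)⁻¹ := by
    have h := geom_sum_Ico_le_of_lt_one hy0 hy1 (m := 0) (n := L + 1)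
    rw [pow_zero, one_div] at h
    rwa [range_eq_Ico]
  have hgeom0 : 0 ≤ ∑ A ∈ range (L + 1), y ^ A := sum_nonneg fun _ _ => pow_nonneg hy0 _
  calc ∑ A ∈ range (L + 1), ∑ B ∈ range (L + 1), ((p : ℝ) ^ max A B)⁻¹
      ≤ ∑ A ∈ range (L + 1), ∑ B ∈ range (L + 1), y ^ A * y ^ B :=
        sum_le_sum fun A _ => sum_le_sum fun B _ => hterm A B
    _ = (∑ A ∈ range (L + 1), y ^ A) * (∑ B ∈ range (L + 1), y ^ B) := by
        rw [sum_mul_sum]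
    _ ≤ (1 - y)⁻¹ * (1 - y)⁻¹ := mul_le_mul hgeom hgeom hgeom0 (by positivity)
    _ ≤ 12 := by
        rw [← mul_inv, inv_le_comm₀ (by nlinarith) (by norm_num)]
        nlinarith

/-- **The small primes**: `‖E_p - E_p(0)‖ ≤ 480 β` whenever `|χ(p)| ≤ 1`, `‖u_j‖ ≤ 1`, `‖v_{ij}‖ ≤ 1`
and `‖1 - v_{1j}‖, ‖1 - v_{2j}‖ ≤ β` (`p ≥ 2`; uniformly in `L` and `v_H`). In the application
`β = σ log p/log R`, which for the boundedly many `p < C₀` is `O(1/log^{1/(7k)} η)`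
("`E_p = 1 + ∑ μ(d₁)⋯μ(d_k) ∏ 1_{(d_i,d_j)∣h_i-h_j}/p + O(1/log^{1/(7k)} η)`").
[cite: TaoTeravainen2021, §8 (the analysis of the primes `p < C₀`)] -/
theorem norm_localE_sub_localE₀_le {p : ℕ} (hp : 2 ≤ p) (vH L : ℕ) {χp : ℝ} (hχ : |χp| ≤ 1)
    {u v₁ v₂ : Fin 2 → ℂ} (hu : ∀ j, ‖u j‖ ≤ 1) (hv₁ : ∀ j, ‖v₁ j‖ ≤ 1) (hv₂ : ∀ j, ‖v₂ j‖ ≤ 1)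
    {β : ℝ} (hβ₁ : ∀ j, ‖1 - v₁ j‖ ≤ β) :
    ‖localE p vH L χp u v₁ v₂ - localE₀ p vH L‖ ≤ 480 * β := by
  have hβ : 0 ≤ β := (norm_nonneg _).trans (hβ₁ 0)
  have hp0 : (0 : ℝ) < p := by exact_mod_cast (show 0 < p by omega)
  -- termwise bound `40 β p^{-max(A,B)}`
  have hCC : ∀ A B : ℕ,
      ‖slotC χp (u 0) (v₁ 0) (v₂ 0) A * slotC χp (u 1) (v₁ 1) (v₂ 1) B - slotC₀ A * slotC₀ B‖ ≤
        40 * β := by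
    intro A B
    set a := slotC χp (u 0) (v₁ 0) (v₂ 0) A
    set b := slotC χp (u 1) (v₁ 1) (v₂ 1) B
    have ha : ‖a - slotC₀ A‖ ≤ 4 * β := norm_slotC_sub_slotC₀_le hχ (hu 0) (hβ₁ 0) (hv₂ 0) A
    have hb : ‖b - slotC₀ B‖ ≤ 4 * β := norm_slotC_sub_slotC₀_le hχ (hu 1) (hβ₁ 1) (hv₂ 1) B
    have hbn : ‖b‖ ≤ 9 := norm_slotC_le hχ (hu 1) (hv₁ 1) (hv₂ 1) B
    have h0 : ‖slotC₀ A‖ ≤ 1 := norm_slotC₀_le A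
    rw [show a * b - slotC₀ A * slotC₀ B = (a - slotC₀ A) * b + slotC₀ A * (b - slotC₀ B) by ring]
    calc ‖(a - slotC₀ A) * b + slotC₀ A * (b - slotC₀ B)‖
        ≤ ‖a - slotC₀ A‖ * ‖b‖ + ‖slotC₀ A‖ * ‖b - slotC₀ B‖ := by
          refine (norm_add_le _ _).trans ?_; rw [norm_mul, norm_mul]
      _ ≤ 4 * β * 9 + 1 * (4 * β) := by gcongr
      _ = 40 * β := by ring
  have hterm : ∀ A B : ℕ,
      ‖(if min A B ≤ vH then ((p : ℂ) ^ max A B)⁻¹ *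
          (slotC χp (u 0) (v₁ 0) (v₂ 0) A * slotC χp (u 1) (v₁ 1) (v₂ 1) B) else 0) -
        (if min A B ≤ vH then ((p : ℂ) ^ max A B)⁻¹ * (slotC₀ A * slotC₀ B) else 0)‖ ≤
        ((p : ℝ) ^ max A B)⁻¹ * (40 * β) := by
    intro A B
    split_ifs
    · rw [← mul_sub, norm_mul, norm_inv, norm_pow, Complex.norm_natCast]
      gcongr
      exact hCC A B
    · simp only [sub_zero, norm_zero]; positivity
  unfold localE localE₀
  rw [← sum_sub_distrib]
  calc _ ≤ ∑ A ∈ range (L + 1), ‖∑ B ∈ range (L + 1),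
          (if min A B ≤ vH then ((p : ℂ) ^ max A B)⁻¹ *
            (slotC χp (u 0) (v₁ 0) (v₂ 0) A * slotC χp (u 1) (v₁ 1) (v₂ 1) B) else 0) -
          ∑ B ∈ range (L + 1),
            (if min A B ≤ vH then ((p : ℂ) ^ max A B)⁻¹ * (slotC₀ A * slotC₀ B) else 0)‖ :=
        norm_sum_le _ _
    _ ≤ ∑ A ∈ range (L + 1), ∑ B ∈ range (L + 1), ((p : ℝ) ^ max A B)⁻¹ * (40 * β) := by
        refine sum_le_sum fun A _ => ?_
        rw [← sum_sub_distrib]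
        exact (norm_sum_le _ _).trans (sum_le_sum fun B _ => hterm A B)
    _ = (∑ A ∈ range (L + 1), ∑ B ∈ range (L + 1), ((p : ℝ) ^ max A B)⁻¹) * (40 * β) := by
        rw [sum_mul]; refine sum_congr rfl fun A _ => ?_; rw [sum_mul]
    _ ≤ 12 * (40 * β) := by
        refine mul_le_mul_of_nonneg_right (sum_sum_inv_pow_max_le hp L) (by positivity)
    _ = 480 * β := by ring

/-- **The generic primes, crude**: for `p ∤ h₁-h₂`, `p ≥ 2`, `L ≥ 1`:
`‖E_p - 1‖ ≤ 26/p` (`‖c_p‖ ≤ 9`, `‖g‖ ≤ 8/p²`). [cite: TaoTeravainen2021, §8 (8.19)] -/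
theorem norm_localE_sub_one_le {p : ℕ} (hp : 2 ≤ p) {L : ℕ} (hL : 1 ≤ L) {χp : ℝ} (hχ : |χp| ≤ 1)
    {u v₁ v₂ : Fin 2 → ℂ} (hu : ∀ j, ‖u j‖ ≤ 1) (hv₁ : ∀ j, ‖v₁ j‖ ≤ 1) (hv₂ : ∀ j, ‖v₂ j‖ ≤ 1) :
    ‖localE p 0 L χp u v₁ v₂ - 1‖ ≤ 26 / p := by
  have hp0 : (0 : ℝ) < p := by exact_mod_cast (show 0 < p by omega)
  have hp2 : (2 : ℝ) ≤ p := by exact_mod_cast hp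
  have hnp : ‖(p : ℂ)‖ = p := Complex.norm_natCast p
  have hside : ∀ j, ‖sideSum p L χp (u j) (v₁ j) (v₂ j)‖ ≤ 13 / p := by
    intro j
    rw [sideSum_eq (by omega) hL]
    have h1 : ‖cCoeff χp (u j) (v₁ j) (v₂ j) / (p : ℂ)‖ ≤ 9 / p := by
      rw [norm_div, hnp]; gcongr; exact norm_cCoeff_le hχ (hu j) (hv₁ j) (hv₂ j)
    have h2 : ‖gTail p L χp (u j) (v₁ j) (v₂ j)‖ ≤ 4 * (2 / (p : ℝ) ^ 2) :=
      (norm_gTail_le hp L hχ (hu j)).trans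
        (mul_le_mul_of_nonneg_right (norm_one_sub_mul_one_sub_le_four (hv₁ j) (hv₂ j))
          (by positivity))
    have h3 : 4 * (2 / (p : ℝ) ^ 2) ≤ 4 / p := by
      rw [mul_div_assoc', div_le_div_iff₀ (by positivity) hp0]
      nlinarith
    calc _ ≤ ‖cCoeff χp (u j) (v₁ j) (v₂ j) / (p : ℂ)‖ + ‖gTail p L χp (u j) (v₁ j) (v₂ j)‖ :=
          norm_add_le _ _
      _ ≤ 9 / p + 4 / p := add_le_add h1 (h2.trans h3)
      _ = 13 / p := by ring
  rw [localE_eq_of_vH_zero, show (1 : ℂ) + sideSum p L χp (u 0) (v₁ 0) (v₂ 0) +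
      sideSum p L χp (u 1) (v₁ 1) (v₂ 1) - 1 =
    sideSum p L χp (u 0) (v₁ 0) (v₂ 0) + sideSum p L χp (u 1) (v₁ 1) (v₂ 1) by ring]
  calc _ ≤ ‖sideSum p L χp (u 0) (v₁ 0) (v₂ 0)‖ + ‖sideSum p L χp (u 1) (v₁ 1) (v₂ 1)‖ :=
        norm_add_le _ _
    _ ≤ 13 / p + 13 / p := add_le_add (hside 0) (hside 1)
    _ = 26 / p := by ring

end MainTerm

end TaoTeravainen

end Literature.Barriers.Parity
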